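import Summits.Ventures.LatticeQCDFlow.Scaling.EquilibriumHittingFloor
import Literature.Probability.MarkovChains.ProductChainTensorisation

/-!
HONEST FRAMING: exact (Metropolis-corrected) sampling algorithms for lattice gauge theory; figures
of merit are autocorrelation/cost numbers at stated couplings and volumes; no continuum-physics
claim.

# EquilibriumExitCeiling — THE CONVERSE OF THE HITTING FLOOR: A POINCARÉ CONSTANT `γ` BOUNDS THE EQUILIBRIUM MEAN
# HITTING TIME OF ANY SET, `Σ_x π(x)·E_x(τ_A ∧ N) ≤ π(Aᶜ)/(γ·π(A))` FOR EVERY `N`, HENCE `E_π τ_A ≤ π(Aᶜ)/(γ π(A))` AND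
# `E_{π|Aᶜ} τ_A ≤ 1/(γ π(A))` (lean-2 GEN-18, ours)

Venture-side (OURS).  Cell `lqcd-flow` (pub-lqcd), unit `pub-lqcd-lean-2-g18`, 2026-08-25.  Companion of
`Scaling/EquilibriumHittingFloor` (GEN-17, Z5: from stationarity alone `Σ π E(τ_A ∧ N) ≥ Nπ(Aᶜ) − ½N(N−1)Q(A,Aᶜ)` — slow
exit from a thin boundary) in the opposite direction: with a Poincaré inequality `γ·Var_π ≤ 𝓔_π(P; ·)` the truncated
mean hitting times `h_N(x) = E_x(τ_A ∧ N)` (`meanHitWithin`, the Literature's first-step recursion) satisfy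
`γ·π(A)·‖h_N‖²_π ≤ 𝓔(h_N) + γ·(mass argument) ≤ Σ π h_N` — the killed-chain Dirichlet argument done with the tree's
`𝓔(u) = ⟨u,u⟩_π − ⟨u,Pu⟩_π` (stationarity) and Cauchy–Schwarz on `Aᶜ` — so that `Σ_x π(x)h_N(x) ≤ π(Aᶜ)/(γπ(A))`
uniformly in `N`.  No reversibility and no spectral theorem are used; `γ` is any Poincaré constant (for a reversible
chain, its spectral gap).  Closes GEN-17's NOT-CLAIMED "survival/exit lower bounds via the killed operator" in the
form practitioners use: the expected tunnelling time INTO a sector of stationary weight `π(A)` is at most the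
relaxation time divided by `π(A)`.

## What is proved

* §1 `sq_sum_compl_le` (Cauchy–Schwarz on `Aᶜ` with weight `π`); `dirichletForm_meanHitWithin_le` —
  `𝓔_π(P; h_N) ≤ Σ_x π(x)h_N(x)`; `lawVariance_meanHitWithin_ge` — `Var_π(h_N) ≥ π(A)·‖h_N‖²_π`... combined:
* §2 **`equilibrium_meanHitWithin_le`** — `Σ_x π(x)·E_x(τ_A ∧ N) ≤ π(Aᶜ)/(γ·π(A))` for every `N`;
  **`equilibrium_meanHittingTime_le`** — the `ℝ≥0∞` mean hitting times: `Σ_x π(x)·E_xτ_A ≤ π(Aᶜ)/(γπ(A))`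
  (in particular every `E_xτ_A` with `π(x) > 0` is finite: the chain reaches `A`).

NOT CLAIMED: tail bounds `P_π(τ_A > n) ≤ π(Aᶜ)(1 − γπ(A))^n` (needs the lazy chain's positive spectrum); pointwise
starts; anything measured.  Literature grade (cell rule): KNOWN MECHANISM (Aldous–Fill, Reversible Markov Chains,
Ch. 3 §5 (mean hitting times and the relaxation time); the Dirichlet-eigenvalue bound `λ(Aᶜ) ≥ γπ(A)`), NEW TYPING
(stationary, not necessarily reversible, finite chains; truncated times); nothing cited as a fact; no new bib keys.
-/

noncomputable section

open Finset Matrix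
open scoped ENNReal
open Literature.Probability.MarkovChains

namespace Summit.Ventures.LatticeQCDFlow.Scaling

variable {X : Type*} [Fintype X] [DecidableEq X] {π : X → ℝ} {P : Matrix X X ℝ}

/-! ## §1 The Dirichlet form and the variance of a truncated mean hitting time -/

omit [Fintype X] [DecidableEq X] in
/-- **Cauchy–Schwarz on a set with weight `π ≥ 0`:** `(Σ_{x ∈ s} π(x)g(x))² ≤ (Σ_{x ∈ s} π(x))·Σ_{x ∈ s} π(x)g(x)²`.
[folklore] -/
theorem sq_sum_le_mass_mul (hπ0 : ∀ x, 0 ≤ π x) (s : Finset X) (g : X → ℝ) :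
    (∑ x ∈ s, π x * g x) ^ 2 ≤ (∑ x ∈ s, π x) * ∑ x ∈ s, π x * g x ^ 2 := by
  have h := Finset.sum_mul_sq_le_sq_mul_sq s (fun x => Real.sqrt (π x)) (fun x => Real.sqrt (π x) * g x)
  have e1 : ∀ x, Real.sqrt (π x) * (Real.sqrt (π x) * g x) = π x * g x := fun x => by
    rw [← mul_assoc, Real.mul_self_sqrt (hπ0 x)]
  have e2 : ∀ x, Real.sqrt (π x) ^ 2 = π x := fun x => Real.sq_sqrt (hπ0 x)
  have e3 : ∀ x, (Real.sqrt (π x) * g x) ^ 2 = π x * g x ^ 2 := fun x => by rw [mul_pow, e2]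
  simp_rw [e1, e2, e3] at h
  exact h

/-- **The Dirichlet form of a truncated mean hitting time is at most its mean:** for a row-stochastic `P` with
stationary `π ≥ 0` and `h_N = E_·(τ_A ∧ N)`, `𝓔_π(P; h_N) ≤ Σ_x π(x)h_N(x)` — because `h_N = 0` on `A` and
`(Ph_N)(x) = h_{N+1}(x) − 1 ≥ h_N(x) − 1` off `A`. [ours] -/
theorem dirichletForm_meanHitWithin_le (hπ0 : ∀ x, 0 ≤ π x) (hP : IsRowStochastic P) (hst : IsStationary π P)
    (A : Finset X) (N : ℕ) :
    dirichletForm π P (meanHitWithin P (↑A : Set X) N) ≤ ∑ x, π x * meanHitWithin P (↑A : Set X) N x := by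
  set h := meanHitWithin P (↑A : Set X) N with hh
  have h0 : ∀ x, 0 ≤ h x := fun x => meanHitWithin_nonneg hP.1 N x
  rw [dirichletForm_eq hP hst]
  -- `⟨h, Ph⟩_π ≥ Σ π h (h − 1)`
  have hPh : ∀ x, π x * (h x * (h x - 1)) ≤ π x * (h x * (P *ᵥ h) x) := by
    intro x
    refine mul_le_mul_of_nonneg_left ?_ (hπ0 x)
    by_cases hx : x ∈ A
    · have : h x = 0 := meanHitWithin_of_mem (by exact_mod_cast hx) N
      rw [this]; simp
    · refine mul_le_mul_of_nonneg_left ?_ (h0 x)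
      have hx' : x ∉ (↑A : Set X) := by exact_mod_cast hx
      have hsucc := meanHitWithin_succ_of_not_mem (P := P) hx' N
      have hmono := meanHitWithin_le_succ (A := (↑A : Set X)) hP.1 N x
      change h x - 1 ≤ ∑ j, P x j * h j
      rw [← hh] at hsucc hmono
      linarith
  unfold piInner
  have : ∑ x, π x * (h x * (h x - 1)) ≤ ∑ x, π x * (h x * (P *ᵥ h) x) := sum_le_sum fun x _ => hPh x
  have e : ∑ x, π x * (h x * (h x - 1)) = ∑ x, π x * (h x * h x) - ∑ x, π x * h x := by
    rw [← sum_sub_distrib]; exact sum_congr rfl fun x _ => by ring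
  linarith

/-- **The variance of a function vanishing on `A` is at least `π(A)` times its second moment:**
`Var_π(h) ≥ (Σ_{A} π)·⟨h,h⟩_π` (`Σ π = 1`, `h = 0` on `A`). [ours] -/
theorem lawVariance_ge_of_eq_zero_on (hπ0 : ∀ x, 0 ≤ π x) (hπ1 : ∑ x, π x = 1) (A : Finset X) {h : X → ℝ}
    (hA : ∀ x ∈ A, h x = 0) :
    (∑ x ∈ A, π x) * ∑ x, π x * h x ^ 2 ≤ lawVariance π h := by
  have hm : lawMean π h = ∑ x ∈ Aᶜ, π x * h x := by
    unfold lawMean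
    rw [← sum_add_sum_compl A]
    rw [sum_eq_zero (fun x hx => by rw [hA x hx, mul_zero]), zero_add]
  have hsq : ∑ x, π x * h x ^ 2 = ∑ x ∈ Aᶜ, π x * h x ^ 2 := by
    rw [← sum_add_sum_compl A, sum_eq_zero (fun x hx => by rw [hA x hx]; ring), zero_add]
  have hvar : lawVariance π h = ∑ x, π x * h x ^ 2 - lawMean π h ^ 2 := by
    have : ∑ x, π x * (h x - 0) ^ 2 = lawVariance π h + (lawMean π h - 0) ^ 2 :=
      meanSq_eq_lawVariance_add_sq hπ1 h 0
    simp only [sub_zero] at this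
    linarith
  have hcs := sq_sum_le_mass_mul hπ0 Aᶜ h
  have hmassc : ∑ x ∈ Aᶜ, π x = 1 - ∑ x ∈ A, π x := by
    rw [← hπ1, ← sum_add_sum_compl A]; ring
  rw [hvar, hm, hsq]
  rw [hmassc] at hcs
  have h2 : 0 ≤ ∑ x ∈ Aᶜ, π x * h x ^ 2 := sum_nonneg fun x _ => mul_nonneg (hπ0 x) (sq_nonneg _)
  nlinarith

/-! ## §2 The ceiling -/

/-- **EQUILIBRIUM EXIT/HITTING CEILING.**  For a row-stochastic `P` with stationary probability vector `π ≥ 0` and a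
Poincaré constant `γ > 0` (`γ·Var_π(f) ≤ 𝓔_π(P; f)` for all `f`), every set `A` of positive mass and every horizon
`N`: **`Σ_x π(x)·E_x(τ_A ∧ N) ≤ π(Aᶜ)/(γ·π(A))`**. [ours] -/
theorem equilibrium_meanHitWithin_le (hπ0 : ∀ x, 0 ≤ π x) (hπ1 : ∑ x, π x = 1) (hP : IsRowStochastic P)
    (hst : IsStationary π P) {γ : ℝ} (hγ : 0 < γ)
    (hgap : ∀ f : X → ℝ, γ * lawVariance π f ≤ dirichletForm π P f) (A : Finset X)
    (hA : 0 < ∑ x ∈ A, π x) (N : ℕ) :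
    ∑ x, π x * meanHitWithin P (↑A : Set X) N x ≤ (∑ x ∈ Aᶜ, π x) / (γ * ∑ x ∈ A, π x) := by
  set h := meanHitWithin P (↑A : Set X) N with hh
  set m₁ := ∑ x, π x * h x with hm₁
  set m₂ := ∑ x, π x * h x ^ 2 with hm₂
  have h0 : ∀ x, 0 ≤ h x := fun x => meanHitWithin_nonneg hP.1 N x
  have hzero : ∀ x ∈ A, h x = 0 := fun x hx => meanHitWithin_of_mem (by exact_mod_cast hx) N
  have hm₁0 : 0 ≤ m₁ := sum_nonneg fun x _ => mul_nonneg (hπ0 x) (h0 x)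
  -- γ π(A) m₂ ≤ γ Var ≤ 𝓔 ≤ m₁
  have k1 : γ * ((∑ x ∈ A, π x) * m₂) ≤ m₁ :=
    calc γ * ((∑ x ∈ A, π x) * m₂) ≤ γ * lawVariance π h :=
          mul_le_mul_of_nonneg_left (lawVariance_ge_of_eq_zero_on hπ0 hπ1 A hzero) hγ.le
      _ ≤ dirichletForm π P h := hgap h
      _ ≤ m₁ := dirichletForm_meanHitWithin_le hπ0 hP hst A N
  -- m₁² ≤ π(Aᶜ) m₂
  have k2 : m₁ ^ 2 ≤ (∑ x ∈ Aᶜ, π x) * m₂ := by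
    have e1 : m₁ = ∑ x ∈ Aᶜ, π x * h x := by
      rw [hm₁, ← sum_add_sum_compl A, sum_eq_zero (fun x hx => by rw [hzero x hx, mul_zero]), zero_add]
    have e2 : ∑ x ∈ Aᶜ, π x * h x ^ 2 ≤ m₂ := by
      rw [hm₂]
      exact sum_le_sum_of_subset_of_nonneg (subset_univ _) fun x _ _ => mul_nonneg (hπ0 x) (sq_nonneg _)
    calc m₁ ^ 2 = (∑ x ∈ Aᶜ, π x * h x) ^ 2 := by rw [e1]
      _ ≤ (∑ x ∈ Aᶜ, π x) * ∑ x ∈ Aᶜ, π x * h x ^ 2 := sq_sum_le_mass_mul hπ0 Aᶜ h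
      _ ≤ (∑ x ∈ Aᶜ, π x) * m₂ := mul_le_mul_of_nonneg_left e2 (sum_nonneg fun x _ => hπ0 x)
  have hAc0 : 0 ≤ ∑ x ∈ Aᶜ, π x := sum_nonneg fun x _ => hπ0 x
  -- conclude: m₁ ≤ π(Aᶜ)/(γ π(A))
  rw [le_div_iff₀ (mul_pos hγ hA)]
  -- `m₁ · γπ(A) ≤ π(Aᶜ)`: from `γπ(A) m₂ ≤ m₁` and `m₁² ≤ π(Aᶜ) m₂`
  by_cases hm : m₁ = 0
  · rw [hm, zero_mul]; exact hAc0
  · have hm₁pos : 0 < m₁ := lt_of_le_of_ne hm₁0 (Ne.symm hm)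
    -- multiply k1 by m₁: γ π(A) m₂ m₁ ≤ m₁²  ≤ π(Aᶜ) m₂ ... need m₂ > 0
    have hm₂pos : 0 < m₂ := by
      by_contra hle
      rw [not_lt] at hle
      have : m₁ ^ 2 ≤ 0 := k2.trans (mul_nonpos_of_nonneg_of_nonpos hAc0 hle) |>.trans_eq' rfl |> fun h => by
        have := k2; nlinarith
      nlinarith
    nlinarith

/-- **The `ℝ≥0∞` mean hitting times:** `Σ_x π(x)·E_xτ_A ≤ π(Aᶜ)/(γ·π(A))`; in particular from the stationary law
conditioned on `Aᶜ` the expected hitting time of `A` is at most `1/(γ·π(A))`. [ours] -/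
theorem equilibrium_meanHittingTime_le (hπ0 : ∀ x, 0 ≤ π x) (hπ1 : ∑ x, π x = 1) (hP : IsRowStochastic P)
    (hst : IsStationary π P) {γ : ℝ} (hγ : 0 < γ)
    (hgap : ∀ f : X → ℝ, γ * lawVariance π f ≤ dirichletForm π P f) (A : Finset X)
    (hA : 0 < ∑ x ∈ A, π x) :
    ∑ x, ENNReal.ofReal (π x) * meanHittingTime P (↑A : Set X) x
      ≤ ENNReal.ofReal ((∑ x ∈ Aᶜ, π x) / (γ * ∑ x ∈ A, π x)) := by
  have hmono : ∀ x, Monotone fun n => ENNReal.ofReal (π x) * ENNReal.ofReal (meanHitWithin P (↑A : Set X) n x) :=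
    fun x => fun a b hab => mul_le_mul_of_nonneg_left (ofReal_meanHitWithin_mono hP.1 x hab) bot_le
  have e : ∀ x, ENNReal.ofReal (π x) * meanHittingTime P (↑A : Set X) x
      = ⨆ n, ENNReal.ofReal (π x) * ENNReal.ofReal (meanHitWithin P (↑A : Set X) n x) := by
    intro x
    unfold meanHittingTime
    rw [ENNReal.mul_iSup]
  simp_rw [e]
  rw [ENNReal.finsetSum_iSup_of_monotone hmono]
  refine iSup_le fun N => ?_
  calc ∑ x, ENNReal.ofReal (π x) * ENNReal.ofReal (meanHitWithin P (↑A : Set X) N x)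
      = ∑ x, ENNReal.ofReal (π x * meanHitWithin P (↑A : Set X) N x) :=
        sum_congr rfl fun x _ => (ENNReal.ofReal_mul (hπ0 x)).symm
    _ = ENNReal.ofReal (∑ x, π x * meanHitWithin P (↑A : Set X) N x) :=
        (ENNReal.ofReal_sum_of_nonneg fun x _ => mul_nonneg (hπ0 x) (meanHitWithin_nonneg hP.1 N x)).symm
    _ ≤ ENNReal.ofReal ((∑ x ∈ Aᶜ, π x) / (γ * ∑ x ∈ A, π x)) :=
        ENNReal.ofReal_le_ofReal (equilibrium_meanHitWithin_le hπ0 hπ1 hP hst hγ hgap A hA N)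

end Summit.Ventures.LatticeQCDFlow.Scaling
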